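import Summits.CriticalPhenomena.PercolationContinuityZ3.Theorems.PercNearOneGluingNoHeavyQuantGatedSliceMixLawRegimeBTwin
import HarnessLib

/-!
# QUANT lane R8, T-DEC, leg (III), blob case — `LawDec.GatedSliceMixLaw'` in REGIME B, cell B-TWIN: the SHARP exchange certificate
# (the exact price `u·w₀ − W_G` of `W_h`'s zero, instead of its upper bound `w_h`)

builds on p205010 (kernel theorem, internal audit signed; external expert review pending)

Support file (`--supports stmt-CriticalPhenomena-4575`), QUANT lane seat prim-quant-arm-3 (gen 120), rung R8 of
`run/shared/lean/prim/quant/LADDER.md`; lead g33's ask (lane INBOX l.1163, HANDOFF GEN-33 TRUE CLOSING: "(PI) for BTwin").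
One theorem, standard axioms, no sorries, no definitions.  It is arm-2 g36's `gatedSliceMixLaw_BTwin_exchange`
(`…QuantGatedSliceMixLawRegimeBTwin`) with the POOLED hypothesis replaced by the EXACT exchange inequality of its own proof.

WHY.  The pooled inequality (PI) of `mixLawCellBTwin_of_pooled` charges the overflow `x_H` of the low `k₁` into `W_h`'s mid `h` at the
full rate `usage(k₁,h)`, using the bound `u·w₀ − W_G ≤ w_h` (top-affordability `y·h ≤ S`) for the price of `W_h`'s zero.  That bound is
lossy exactly where the cell is hard: this seat's exact census finds (PI) FALSE as a pure inequality without `W_h ∉ D` (e.g. `y = 8/33,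
z = 0, g = 26/75, λ = 1/6, a = 1, k₁ = 1, k₂ = M = 11, h = j = 3`: (PI) fails by `17/2250` while the mixture is DEC at `θ = 1615/98559`),
and with `W_h ∉ D` true but within `0.24 %` of equality.  The exact criterion E of the same routing reads
  `D·(u·w₀ − W_G) ≤ w_h·((1−z)λ − u z − u x_G)`,  `D = usage(k₁,h)·x_H`, `w₀ = 1 − S/h`, `w_h = (S/h)(1−g)`, `W_G = (S/h)g`,
and is what `mixLawCellBTwin_holds` (`…QuantGatedSliceMixLawBTwinHolds`) verifies on the cell (≥ 14 % relative slack in the seat census).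

* **`LawDec.gatedSliceMixLaw_BTwin_exchange_sharp`** — cell B-TWIN frame ∧ split `x_P + x_H + x_G = m₁` ∧ the exact exchange
  inequality ⟹ the conclusion of `GatedSliceMixLaw'` (`θ = D/(w_h + D)`).  Proof = arm-2 g36's, verbatim after the exchange step.
HONEST STATUS: support lemma; `MixLawRegimeB`, `GatedSliceMixLaw'`, CW, `SingleGateConvClosed`, `TreeDEC`, `FarTreeRow` OPEN; RATE class
log* / honest sentence unchanged.

[this work]; the flow pieces and the exchange architecture: prim-quant-arm-2 g36, prim-quant-stmt g22–g30 (this lane).  Nothing here is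
cited as a published result.  The gluing rows served [cite: KozmaNitzan2024, Conjecture 3 (p. 15)]; product measure
[cite: Grimmett1999, §1.3 p. 10].
-/

noncomputable section

namespace Summit.CriticalPhenomena.PercolationContinuityZ3.Theorems

namespace Quant

open Finset

/-- the two-point law `{lo, hi; g}` (as in `…QuantLawDEC`) -/
local notation3 "TP[" lo ", " hi ", " g ", " h "]" =>
  (g : ℝ) * (if (h : ℕ) = (hi : ℕ) then (1 : ℝ) else 0) + (1 - (g : ℝ)) * (if (h : ℕ) = (lo : ℕ) then (1 : ℝ) else 0)

namespace LawDec

set_option maxHeartbeats 800000 in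
/-- **`GatedSliceMixLaw'` ON CELL B-TWIN FROM THE EXACT EXCHANGE INEQUALITY.**  Regime B (`h + a ≥ j+1`, `t ≤ 2h`), `k₁` a
`t`-low, its twin `ℓ = k₁ + a ≤ j` a mid (`t ≤ 2ℓ`), `k₂ ≥ j+1`, `g < 1`; a split `x_P + x_H + x_G = m₁` of the low `k₁` (twin / `W_h`'s
mid / giants, each mid used only when compatible, the twin within capacity) with
`usage(k₁,h)·x_H·(u(1 − S/h) − (S/h)g) ≤ (S/h)(1−g)·((1−z)λ − u z − u x_G)` (`u = y/(1−y)`): then `θ·W_h + (1−θ)·P` is DEC at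
`θ = D/(w_h + D)`, `D = usage(k₁,h)·x_H`. [this work] -/
theorem gatedSliceMixLaw_BTwin_exchange_sharp (y z g S lam : ℝ) (a j M h k₁ k₂ : ℕ) (xP xH xG : ℝ)
    (hy0 : 0 < y) (hy1 : y < 1) (hz0 : 0 ≤ z) (hz1 : z < 1) (hg0 : 0 ≤ g) (hg1 : g < 1)
    (hS0 : 0 < S) (hhj : h ≤ j) (hhM : h ≤ M) (hSh : S < (h : ℝ))
    (hk : k₁ ≤ k₂) (hk₂M : k₂ ≤ M) (hlam0 : 0 ≤ lam) (hlam1 : lam ≤ 1)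
    (hk₁j : k₁ ≤ j) (hk₁low : 2 * (k₁ : ℝ) < S + (a : ℝ) * g * (1 - z))
    (hPj : k₁ + a ≤ j) (hPmid : S + (a : ℝ) * g * (1 - z) ≤ 2 * ((k₁ + a : ℕ) : ℝ))
    (hk₂G : j + 1 ≤ k₂) (hhaG : j + 1 ≤ h + a) (hhmid : S + (a : ℝ) * g * (1 - z) ≤ 2 * (h : ℝ))
    (hxP0 : 0 ≤ xP) (hxH0 : 0 ≤ xH) (hxG0 : 0 ≤ xG) (hsplit : xP + xH + xG = (1 - z) * (1 - lam) * (1 - g))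
    (hPcomp : 0 < xP → S + (a : ℝ) * g * (1 - z) < (k₁ : ℝ) + ((k₁ + a : ℕ) : ℝ))
    (hHcomp : 0 < xH → S + (a : ℝ) * g * (1 - z) < (k₁ : ℝ) + (h : ℝ))
    (hcapP : usage y (S + (a : ℝ) * g * (1 - z)) j k₁ (k₁ + a) * xP ≤ (1 - z) * (1 - lam) * g)
    (hEx : usage y (S + (a : ℝ) * g * (1 - z)) j k₁ h * xH * (y / (1 - y) * (1 - S / h) - S / h * g)
      ≤ S / h * (1 - g) * ((1 - z) * lam - y / (1 - y) * z - y / (1 - y) * xG)) :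
    ∃ θ : ℝ, 0 ≤ θ ∧ θ < 1 ∧
      DECAtT y (S + (a : ℝ) * g * (1 - z)) j (M + a)
        (fun p => θ * weakMidLaw S g h a p
          + (1 - θ) * (z * (if p = 0 then (1 : ℝ) else 0) + (1 - z) * slice (fun q => TP[k₁, k₂, lam, q]) a g p)) := by
  classical
  set t : ℝ := S + (a : ℝ) * g * (1 - z) with ht
  -- positivity
  have h1z : 0 < 1 - z := by linarith
  have h1y : 0 < 1 - y := by linarith
  have h1g : 0 < 1 - g := by linarith
  have hh0 : (0 : ℝ) < h := lt_trans hS0 hSh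
  have hu0 : 0 < y / (1 - y) := div_pos hy0 h1y
  have h1lam : 0 ≤ 1 - lam := by linarith
  -- masses
  set m₁' : ℝ := (1 - z) * (1 - lam) * g with hm₁'
  have hm₁'0 : 0 ≤ m₁' := mul_nonneg (mul_nonneg h1z.le h1lam) hg0
  have hwh : 0 < S / h * (1 - g) := mul_pos (div_pos hS0 hh0) h1g
  have hw0 : 0 ≤ 1 - S / (h : ℝ) := by rw [sub_nonneg, div_le_one hh0]; exact hSh.le
  have hWG : 0 ≤ S / h * g := mul_nonneg (div_pos hS0 hh0).le hg0
  -- the donor rate into `h` and `D`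
  obtain ⟨UH, hUHd⟩ : ∃ q : ℝ, q = usage y t j k₁ h := ⟨_, rfl⟩
  obtain ⟨UP, hUPd⟩ : ∃ q : ℝ, q = usage y t j k₁ (k₁ + a) := ⟨_, rfl⟩
  rw [← hUHd] at hEx
  rw [← hUPd] at hcapP
  obtain ⟨D, hD⟩ : ∃ q : ℝ, q = UH * xH := ⟨_, rfl⟩
  have hD0 : 0 ≤ D := by
    rcases eq_or_lt_of_le hxH0 with hx0 | hxpos
    · rw [hD, ← hx0, mul_zero]
    · have hc := hHcomp hxpos
      have hk1h : k₁ < h := by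
        have : (k₁ : ℝ) < h := by linarith
        exact_mod_cast this
      have hUH0 : 0 < UH := by rw [hUHd]; exact usage_pos_of_compat y t j k₁ h hy0 hy1 hk₁low hk1h (Or.inr hc)
      rw [hD]; exact mul_nonneg hUH0.le hxH0
  -- the exchange inequality (hypothesis, with `D = usage(k₁,h)·x_H`)
  have hEx' : D * (y / (1 - y) * (1 - S / h) - S / h * g) ≤ S / h * (1 - g) * ((1 - z) * lam - y / (1 - y) * z - y / (1 - y) * xG) := by
    rw [hD]; exact hEx
  -- piece 1: the low k₁ into its twin (pair when compatible, else x_P = 0 and the twin is a point)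
  have PP : FlowAtT y t j (M + a)
      (fun p => S / h * (1 - g) * xP * (if p = k₁ then (1 : ℝ) else 0) + S / h * (1 - g) * m₁' * (if p = k₁ + a then (1 : ℝ) else 0)) := by
    by_cases hcP : t < (k₁ : ℝ) + ((k₁ + a : ℕ) : ℝ)
    · refine flowAtT_pair y t j (M + a) k₁ (k₁ + a) (S / h * (1 - g) * xP) (S / h * (1 - g) * m₁') hk₁j hk₁low (by omega)
        (Or.inr hPmid) (Or.inr hcP) (mul_nonneg hwh.le hxP0) ?_
      calc usage y t j k₁ (k₁ + a) * (S / h * (1 - g) * xP) = S / h * (1 - g) * (UP * xP) := by rw [hUPd]; ring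
        _ ≤ S / h * (1 - g) * m₁' := mul_le_mul_of_nonneg_left hcapP hwh.le
    · have hxP : xP = 0 := by
        by_contra hne
        exact hcP (hPcomp (lt_of_le_of_ne hxP0 (Ne.symm hne)))
      have Ppt := flowAtT_point y t j (M + a) (k₁ + a) (S / h * (1 - g) * m₁') (fun hc => by linarith [hc.2]) (mul_nonneg hwh.le hm₁'0)
      refine (congrArg (FlowAtT y t j (M + a)) (funext fun p => ?_)).mp Ppt
      rw [hxP]; ring
  -- piece 2: the overflow into W_h's mid h (exactly full), or nothing
  have PH : FlowAtT y t j (M + a)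
      (fun p => S / h * (1 - g) * xH * (if p = k₁ then (1 : ℝ) else 0) + D * (S / h * (1 - g)) * (if p = h then (1 : ℝ) else 0)) := by
    by_cases hcH : t < (k₁ : ℝ) + h
    · refine flowAtT_pair y t j (M + a) k₁ h (S / h * (1 - g) * xH) (D * (S / h * (1 - g))) hk₁j hk₁low (by omega)
        (Or.inr hhmid) (Or.inr hcH) (mul_nonneg hwh.le hxH0) (le_of_eq ?_)
      rw [hD, hUHd]; ring
    · have hxH : xH = 0 := by
        by_contra hne
        exact hcH (hHcomp (lt_of_le_of_ne hxH0 (Ne.symm hne)))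
      have hD0' : D = 0 := by rw [hD, hxH, mul_zero]
      have Ppt := flowAtT_point y t j (M + a) h 0 (fun hc => by linarith [hc.2]) le_rfl
      refine (congrArg (FlowAtT y t j (M + a)) (funext fun p => ?_)).mp Ppt
      rw [hxH, hD0']; ring
  -- piece 3: zeros + the giant part of k₁ + the three giant atoms, by criterion E
  set G : ℕ → ℝ := fun p => (D * (1 - S / h) + S / h * (1 - g) * z) * (if p = 0 then (1 : ℝ) else 0)
      + S / h * (1 - g) * xG * (if p = k₁ then (1 : ℝ) else 0)
      + D * (S / h * g) * (if p = h + a then (1 : ℝ) else 0)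
      + S / h * (1 - g) * ((1 - z) * lam * (1 - g)) * (if p = k₂ then (1 : ℝ) else 0)
      + S / h * (1 - g) * ((1 - z) * lam * g) * (if p = k₂ + a then (1 : ℝ) else 0) with hG
  have hind : ∀ (q : Prop) [Decidable q], (0 : ℝ) ≤ (if q then (1 : ℝ) else 0) := by
    intro q _; split <;> norm_num
  have hc0 : 0 ≤ D * (1 - S / h) + S / h * (1 - g) * z := add_nonneg (mul_nonneg hD0 hw0) (mul_nonneg hwh.le hz0)
  have hc1 : 0 ≤ S / h * (1 - g) * xG := mul_nonneg hwh.le hxG0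
  have hc2 : 0 ≤ D * (S / h * g) := mul_nonneg hD0 hWG
  have hc3 : 0 ≤ S / h * (1 - g) * ((1 - z) * lam * (1 - g)) := mul_nonneg hwh.le (mul_nonneg (mul_nonneg h1z.le hlam0) h1g.le)
  have hc4 : 0 ≤ S / h * (1 - g) * ((1 - z) * lam * g) := mul_nonneg hwh.le (mul_nonneg (mul_nonneg h1z.le hlam0) hg0)
  have hG0 : ∀ p, 0 ≤ G p := by
    intro p
    simp only [hG]
    exact add_nonneg (add_nonneg (add_nonneg (add_nonneg (mul_nonneg hc0 (hind _)) (mul_nonneg hc1 (hind _)))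
      (mul_nonneg hc2 (hind _))) (mul_nonneg hc3 (hind _))) (mul_nonneg hc4 (hind _))
  have hGlow : ∑ l ∈ Finset.range (j + 1), G l = D * (1 - S / h) + S / h * (1 - g) * z + S / h * (1 - g) * xG := by
    simp only [hG, Finset.sum_add_distrib]
    rw [sum_mul_indicator (fun _ => D * (1 - S / h) + S / h * (1 - g) * z) j 0 (by omega),
      sum_mul_indicator (fun _ => S / h * (1 - g) * xG) j k₁ hk₁j,
      sum_mul_indicator_eq_zero (fun _ => D * (S / h * g)) j (h + a) (by omega),
      sum_mul_indicator_eq_zero (fun _ => S / h * (1 - g) * ((1 - z) * lam * (1 - g))) j k₂ (by omega),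
      sum_mul_indicator_eq_zero (fun _ => S / h * (1 - g) * ((1 - z) * lam * g)) j (k₂ + a) (by omega)]
    ring
  have hGall : ∑ p ∈ Finset.range (M + a + 1), G p
      = D * (1 - S / h) + S / h * (1 - g) * z + S / h * (1 - g) * xG
        + (D * (S / h * g) + S / h * (1 - g) * ((1 - z) * lam * (1 - g)) + S / h * (1 - g) * ((1 - z) * lam * g)) := by
    simp only [hG, Finset.sum_add_distrib]
    rw [sum_mul_indicator (fun _ => D * (1 - S / h) + S / h * (1 - g) * z) (M + a) 0 (by omega),
      sum_mul_indicator (fun _ => S / h * (1 - g) * xG) (M + a) k₁ (by omega),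
      sum_mul_indicator (fun _ => D * (S / h * g)) (M + a) (h + a) (by omega),
      sum_mul_indicator (fun _ => S / h * (1 - g) * ((1 - z) * lam * (1 - g))) (M + a) k₂ (by omega),
      sum_mul_indicator (fun _ => S / h * (1 - g) * ((1 - z) * lam * g)) (M + a) (k₂ + a) (by omega)]
    ring
  have hGIco : ∑ p ∈ Finset.Ico (j + 1) (M + a + 1), G p
      = D * (S / h * g) + S / h * (1 - g) * ((1 - z) * lam * (1 - g)) + S / h * (1 - g) * ((1 - z) * lam * g) := by
    have := Finset.sum_range_add_sum_Ico G (show j + 1 ≤ M + a + 1 by omega)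
    rw [hGall, hGlow] at this
    linarith
  have PG : FlowAtT y t j (M + a) G := by
    refine flowAtT_of_giants y t j (M + a) G hy0 hy1 hG0 ?_
    have hle : ∑ l ∈ Finset.range (j + 1), (if 2 * (l : ℝ) < t then G l else 0)
        ≤ D * (1 - S / h) + S / h * (1 - g) * z + S / h * (1 - g) * xG := by
      rw [← hGlow]
      exact Finset.sum_le_sum fun l _ => by
        by_cases h2 : 2 * (l : ℝ) < t
        · rw [if_pos h2]
        · rw [if_neg h2]; exact hG0 l
    rw [hGIco]
    refine le_trans (mul_le_mul_of_nonneg_left hle hu0.le) ?_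
    have e : D * (S / h * g) + S / h * (1 - g) * ((1 - z) * lam * (1 - g)) + S / h * (1 - g) * ((1 - z) * lam * g)
        = D * (S / h * g) + S / h * (1 - g) * ((1 - z) * lam) := by ring
    rw [e]
    have e2 : y / (1 - y) * (D * (1 - S / h) + S / h * (1 - g) * z + S / h * (1 - g) * xG)
        - (D * (S / h * g) + S / h * (1 - g) * ((1 - z) * lam))
        = D * (y / (1 - y) * (1 - S / h) - S / h * g)
          - S / h * (1 - g) * ((1 - z) * lam - y / (1 - y) * z - y / (1 - y) * xG) := by ring
    linarith [hEx', e2]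
  -- assemble: D·W_h + w_h·P is flow-feasible
  have hsum := FlowAtT.add (FlowAtT.add PP PH) PG
  have key : ∀ p, D * weakMidLaw S g h a p
        + S / h * (1 - g) * (z * (if p = 0 then (1 : ℝ) else 0) + (1 - z) * slice (fun q => TP[k₁, k₂, lam, q]) a g p)
      = (S / h * (1 - g) * xP * (if p = k₁ then (1 : ℝ) else 0) + S / h * (1 - g) * m₁' * (if p = k₁ + a then (1 : ℝ) else 0))
        + (S / h * (1 - g) * xH * (if p = k₁ then (1 : ℝ) else 0) + D * (S / h * (1 - g)) * (if p = h then (1 : ℝ) else 0))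
        + G p := by
    intro p
    rw [movedTwoPoint_apply]
    simp only [weakMidLaw, hG, hm₁']
    linear_combination (-(S / h * (1 - g) * (if p = k₁ then (1 : ℝ) else 0))) * hsplit
  have hR' : FlowAtT y t j (M + a) (fun p => D * weakMidLaw S g h a p
      + S / h * (1 - g) * (z * (if p = 0 then (1 : ℝ) else 0) + (1 - z) * slice (fun q => TP[k₁, k₂, lam, q]) a g p)) := by
    refine (congrArg (FlowAtT y t j (M + a)) (funext fun p => ?_)).mp hsum
    exact (key p).symm
  -- normalise: θ = D/(w_h + D)
  have hden : 0 < S / h * (1 - g) + D := add_pos_of_pos_of_nonneg hwh hD0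
  obtain ⟨θ, hθ⟩ : ∃ q : ℝ, q = D / (S / h * (1 - g) + D) := ⟨_, rfl⟩
  have hθ0 : 0 ≤ θ := by rw [hθ]; exact div_nonneg hD0 hden.le
  have hθ1 : θ < 1 := by rw [hθ, div_lt_one hden]; linarith
  have h1θ : 1 - θ = S / h * (1 - g) / (S / h * (1 - g) + D) := by
    rw [hθ]; field_simp; ring
  have hR := hR'.smul (1 / (S / h * (1 - g) + D)) (by positivity)
  refine gatedSliceMixLaw_conclusion_of_flowAtT y z g S lam θ a j M h k₁ k₂ hy0 hy1 hhM hk hk₂M hθ0 hθ1 ?_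
  refine (congrArg (FlowAtT y t j (M + a)) (funext fun p => ?_)).mp hR
  rw [h1θ, hθ, div_eq_mul_one_div D, div_eq_mul_one_div (S / h * (1 - g)) (S / h * (1 - g) + D)]
  ring

end LawDec

end Quant

end Summit.CriticalPhenomena.PercolationContinuityZ3.Theorems
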